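import Summits.QuantumFields.YangMills.Theorems.UnitScaleTiltProp7BernPFlatMember
import Summits.QuantumFields.YangMills.Theorems.UnitScaleTiltProp7CombBoxBlockDictionary
import Summits.QuantumFields.YangMills.Theorems.UnitScaleTiltProp7PinnedHodgeSplit
import HarnessLib

/-!
# Route `UnitScaleTilt`, crux K1 «MinimiserStabilityRegPr» (stmt-QuantumFields-19200), stub `stub_existenceMinimalOrbit` (EX) — N06 print row `h349`, FLAT-CERTIFICATE ROAD,
# FILE 3a∕4 «THE RESIDUAL GAUGE ALGEBRA AT THE FLAT MEMBER»: **`N_S(1) = ker(Q(1)∘D_1)` IS EXACTLY THE GAUGE PARAMETERS WITH CONSTANT `(K−n)`-BLOCK SUMS** — the flat (3.115)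
# `Q_k(1)∂λ = ∂(Q′_k λ)` ([Balaban1985BackgroundPropagators] p. 418, ✓`Prop7CombBoxBlockDictionary.QTwS_one_gaugeDir_siteAvgIter`) read both ways, plus the connectedness of the coarse torus

Cell `ym3-torus`, width seat `ym3-torus-px20` (gen 6); pen «FLAT-CERT `h349(1)`» (★★OWNER g30 WORD 5 ∕ ★w2-19200 g8 08:25:14Z GO, certificate class).  THEOREMS ONLY (0 `def`, 0 `sorry`);
`--supports stmt-QuantumFields-19200 --as helper`, count-neutral.  YM₃ on T³ is a ladder rung (R3), not the Clay problem; nothing here claims `h349`, N06, the stub, the crux or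
the mass gap.

WHY (memo `LOCATE-H349-FLATCERT-TOWER-px20g6.md` §4 F3 (ii)).  The flat certificate compares the route's gauge projector `R_S(1)` (✓`Prop7SectET3GaugeProjector.RS`, the projection
onto `Δ^η_1 N_S(1)`) with the NE9 tower's `R_k(1)` (`B9Eq326OperatorTower.RofUk … 1`, the projection onto `Δ^η_1 N(Q′_k(1))`).  `N(Q′_k(1))` = zero block means; this file shows
`N_S(1)` = CONSTANT block sums (§2–§3) and that constants are `Δ^η_1`-invisible (§1), whence `Δ^η_1 N_S(1) = Δ^η_1 N(Q′_k(1))` (FILE 3b).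

WHAT IS PROVED (ns `Summit.QuantumFields.YangMills.Theorems.Prop7FlatResidualAlgebra`; member `F n K`, `h : n ≤ K`, weights `c₀ cB`):
* §1 `DL2_one_toL2S_const` (`D_1` kills constants), `toL2S_const_mem_NS_one`, `covLapSite_one_toL2S_const` (`Δ^η_1` kills constants).
* §2 ★★ `blockSum_eq_of_mem_NS_one` — `toL2S λ ∈ N_S(1)` ⟹ all `(K−n)`-block sums of `λ` are equal (flat (3.115) + ✓`Prop7PinnedHodgeSplit.const_of_grad_eq_zero` on the eight real
  components of the coarse block mean).
* §3 ★★ `toL2S_mem_NS_one_iff` — `toL2S λ ∈ N_S(1) ↔ ∃ C, ∀ y, Σ_{x∈B^{K−n}(y)} λ(x) = C` (⇐: subtract the constant `C∕L^{3(K−n)}`, ✓`Prop7BernPFlatMember.toL2S_mem_NS_one_of_blockSum_eq_zero`, §1).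
HONEST SCOPE.  Flat member only; linear algebra over landed letters; no estimate.  Rung R3, not Clay; YM gap NOT proved.

References: T. Bałaban, CMP **99** (1985) 389–434 [Balaban1985BackgroundPropagators] ((3.19)–(3.21) pp.393–394, (3.115) p.418); CMP **95** (1984) 17–40 [Balaban1984PropagatorsI]
((1.18)–(1.20) p.20, p.22).
-/

set_option autoImplicit false

noncomputable section

open scoped InnerProductSpace ComplexConjugate Matrix.Norms.L2Operator BigOperators

namespace Summit.QuantumFields.YangMills.Theorems.Prop7FlatResidualAlgebra

open Literature.MathematicalPhysics.QuantumFieldTheory.Balaban1983to89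
open Literature.MathematicalPhysics.QuantumFieldTheory.Balaban1983to89.T3ContinuumYM3Torus
open T3SectALandauChart (eta eta_pos)
open T3LevelShift (siteShift bondShift bondShift_tgt)
open T3PrintedRegularOrbits (sites_eq)
open LatticeFieldCalculus (grad laplace siteAvgIter)
open B5Eq118OneStroke (iterBlock mem_iterBlock_iff siteAvgIter_eq_blockSum card_iterBlock)
open B11Eq103H1Complex (SiteL2K BondL2K)
open Summit.QuantumFields.YangMills.Theorems.Prop7SectET3Transport (periodsT3 siteEquiv)
open Summit.QuantumFields.YangMills.Theorems.Prop7SectET3HilbertLetters (W₂ frobEquiv toL2 toL2S toL2B QL2 DL2 covLapSite QL2_toL2)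
open Summit.QuantumFields.YangMills.Theorems.Prop7SectET3GaugeProjector (QDS NS QDS_apply mem_NS_iff mem_NS_of_DL2_eq_zero)
open Summit.QuantumFields.YangMills.Theorems.Prop7SymAvgTwSym (QTwS)
open Summit.QuantumFields.YangMills.Theorems.Prop7BernPFlatMember (DL2_one_toL2S toL2S_mem_NS_one_of_blockSum_eq_zero)
open Summit.QuantumFields.YangMills.Theorems.Prop7CombBoxBlockDictionary (QTwS_one_gaugeDir_siteAvgIter)
open Summit.QuantumFields.YangMills.Theorems.Prop7PinnedHodgeSplit (const_of_grad_eq_zero)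

variable (F : T3Family) (n K : ℕ) (h : n ≤ K) (c₀ cB : ℝ) [Fact (0 < c₀)]

/-! ## §1 Constants: `D_1` and `Δ^η_1` kill them; they are residual -/

/-- `D_1` kills a constant gauge parameter. [cite: Balaban1985BackgroundPropagators, (3.3) p.391] -/
theorem DL2_one_toL2S_const (Z : Matrix (Fin 2) (Fin 2) ℂ) :
    DL2 F n K c₀ (1 : GaugeField (F.P K) 0 (Matrix.specialUnitaryGroup (Fin 2) ℂ)) (toL2S F K c₀ fun _ => Z) = 0 := by
  rw [DL2_one_toL2S]
  have : (fun b : PBond (F.P K) 0 => (((eta F n K : ℝ) : ℂ)⁻¹) • ((fun _ : Site (F.P K) 0 => Z) b.tgt - (fun _ : Site (F.P K) 0 => Z) b.src)) = 0 := by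
    funext b; simp
  rw [this, map_zero]

/-- **Constants are residual**: `toL2S (x ↦ Z) ∈ N_S(1)`. [cite: Balaban1985BackgroundPropagators, (3.21) p.394] -/
theorem toL2S_const_mem_NS_one (Z : Matrix (Fin 2) (Fin 2) ℂ) :
    toL2S F K c₀ (fun _ => Z) ∈ NS F n K h c₀ cB (1 : GaugeField (F.P K) 0 (Matrix.specialUnitaryGroup (Fin 2) ℂ)) :=
  mem_NS_of_DL2_eq_zero _ (DL2_one_toL2S_const F n K c₀ Z)

/-- `Δ^η_1 = D_1†D_1` kills constants. [cite: Balaban1985BackgroundPropagators, (3.23) p.394] -/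
theorem covLapSite_one_toL2S_const (Z : Matrix (Fin 2) (Fin 2) ℂ) :
    covLapSite F n K c₀ (1 : GaugeField (F.P K) 0 (Matrix.specialUnitaryGroup (Fin 2) ℂ)) (toL2S F K c₀ fun _ => Z) = 0 := by
  rw [covLapSite, LinearMap.comp_apply, DL2_one_toL2S_const, map_zero]

/-! ## §2 `N_S(1)` ⟹ constant block sums -/

omit [Fact (0 < c₀)] in
/-- A matrix field on the coarse torus whose every unit difference vanishes is constant (the torus is connected; ✓`const_of_grad_eq_zero` on the eight real components).
[cite: Balaban1984PropagatorsI, p.22 (text)] -/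
theorem eq_default_of_forall_shift {P : Params} {j : ℕ} (T : Site P j → Matrix (Fin 2) (Fin 2) ℂ) (hT : ∀ b : PBond P j, T b.tgt = T b.src) (x : Site P j) :
    T x = T default := by
  ext i i'
  apply Complex.ext
  · have hg : ∀ b : PBond P j, grad 1 (fun z => (T z i i').re) b = 0 := fun b => by
      simp only [grad, one_smul, hT b, sub_self]
    exact const_of_grad_eq_zero one_ne_zero hg x
  · have hg : ∀ b : PBond P j, grad 1 (fun z => (T z i i').im) b = 0 := fun b => by
      simp only [grad, one_smul, hT b, sub_self]
    exact const_of_grad_eq_zero one_ne_zero hg x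

/-- ★★ **`toL2S λ ∈ N_S(1)` ⟹ THE COARSE BLOCK MEAN OF `λ` IS CONSTANT**: `Q(1)(D_1λ) = 0` reads, by the flat (3.115) ✓`QTwS_one_gaugeDir_siteAvgIter`, «the coarse gradient of
`Q′_{K−n} λ` vanishes», and the coarse torus is connected. [cite: Balaban1985BackgroundPropagators, (3.115) p.418, (3.21) p.394; Balaban1984PropagatorsI, (1.20) p.20] -/
theorem siteAvgIter_eq_of_mem_NS_one (lam : Site (F.P K) 0 → Matrix (Fin 2) (Fin 2) ℂ)
    (hl : toL2S F K c₀ lam ∈ NS F n K h c₀ cB (1 : GaugeField (F.P K) 0 (Matrix.specialUnitaryGroup (Fin 2) ℂ))) (y y' : Site (F.P K) (K - n)) :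
    siteAvgIter (K - n) lam y = siteAvgIter (K - n) lam y' := by
  -- `Q(1)(D_1 λ) = 0` on the route's coarse bonds
  have h0 : QL2 F n K h c₀ cB 1 (DL2 F n K c₀ 1 (toL2S F K c₀ lam)) = 0 := (mem_NS_iff _ _).1 hl
  rw [DL2_one_toL2S, QL2_toL2] at h0
  have h1 : QTwS F n K h (1 : GaugeField (F.P K) 0 (Matrix.specialUnitaryGroup (Fin 2) ℂ))
      (fun b : PBond (F.P K) 0 => (((eta F n K : ℝ) : ℂ)⁻¹) • (lam b.tgt - lam b.src)) = 0 :=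
    (toL2B F n cB).map_eq_zero_iff.1 h0
  -- the gauge direction of `λ′ := −η⁻¹•λ`
  set lam' : Site (F.P K) 0 → Matrix (Fin 2) (Fin 2) ℂ := fun x => (-(((eta F n K : ℝ) : ℂ)⁻¹)) • lam x with hlam'
  have hdir : (fun b : PBond (F.P K) 0 => (((eta F n K : ℝ) : ℂ)⁻¹) • (lam b.tgt - lam b.src)) = fun b => lam' b.src - lam' b.tgt := by
    funext b; simp only [hlam', neg_smul, smul_sub]; abel
  rw [hdir, QTwS_one_gaugeDir_siteAvgIter F h lam'] at h1
  -- the coarse block mean of `λ′` has vanishing unit differences on the coarse torus `F.P n`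
  have hT : ∀ c : PBond (F.P n) 0, (siteAvgIter (K - n) lam' ∘ siteShift (sites_eq F n K h)) c.tgt = (siteAvgIter (K - n) lam' ∘ siteShift (sites_eq F n K h)) c.src := by
    intro c
    have hc := congr_fun h1 c
    simp only [Pi.zero_apply, sub_eq_zero] at hc
    exact hc.symm
  have hconst := eq_default_of_forall_shift _ hT
  -- read back at `y`, `y′` through the level shift
  have hy := hconst ((siteShift (sites_eq F n K h)).symm y)
  have hy' := hconst ((siteShift (sites_eq F n K h)).symm y')
  simp only [Function.comp_apply, Equiv.apply_symm_apply] at hy hy'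
  have hmean : siteAvgIter (K - n) lam' y = siteAvgIter (K - n) lam' y' := by rw [hy, hy']
  -- undo the factor `−η⁻¹`
  have hk : K - n ≤ (F.P K).m + (F.P K).K := by have := F.hm; show K - n ≤ F.m + K; omega
  have hη : (-(((eta F n K : ℝ) : ℂ)⁻¹)) ≠ 0 := neg_ne_zero.2 (inv_ne_zero (by exact_mod_cast (eta_pos F n K).ne'))
  rw [siteAvgIter_eq_blockSum (K - n) hk, siteAvgIter_eq_blockSum (K - n) hk] at hmean ⊢
  have hs : ∀ z : Site (F.P K) (K - n), ∑ x ∈ iterBlock (K - n) z, lam' x = (-(((eta F n K : ℝ) : ℂ)⁻¹)) • ∑ x ∈ iterBlock (K - n) z, lam x :=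
    fun z => by rw [hlam', Finset.smul_sum]
  rw [hs, hs, smul_comm, smul_comm ((((((F.P K).L : ℝ) ^ (F.P K).d) ^ (K - n))⁻¹)) (-(((eta F n K : ℝ) : ℂ)⁻¹))] at hmean
  exact smul_right_injective _ hη hmean

/-- ★★ **`toL2S λ ∈ N_S(1)` ⟹ ALL `(K−n)`-BLOCK SUMS OF `λ` ARE EQUAL.** [cite: Balaban1985BackgroundPropagators, (3.115) p.418, (3.21) p.394] -/
theorem blockSum_eq_of_mem_NS_one (lam : Site (F.P K) 0 → Matrix (Fin 2) (Fin 2) ℂ)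
    (hl : toL2S F K c₀ lam ∈ NS F n K h c₀ cB (1 : GaugeField (F.P K) 0 (Matrix.specialUnitaryGroup (Fin 2) ℂ))) (y y' : Site (F.P K) (K - n)) :
    ∑ x ∈ iterBlock (K - n) y, lam x = ∑ x ∈ iterBlock (K - n) y', lam x := by
  have hk : K - n ≤ (F.P K).m + (F.P K).K := by have := F.hm; show K - n ≤ F.m + K; omega
  have hm := siteAvgIter_eq_of_mem_NS_one F n K h c₀ cB lam hl y y'
  rw [siteAvgIter_eq_blockSum (K - n) hk, siteAvgIter_eq_blockSum (K - n) hk] at hm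
  have hc : ((((((F.P K).L : ℝ) ^ (F.P K).d) ^ (K - n))⁻¹)) ≠ 0 :=
    inv_ne_zero (pow_ne_zero _ (pow_ne_zero _ (by exact_mod_cast (F.P K).L_pos.ne')))
  exact smul_right_injective _ hc hm

/-! ## §3 The characterisation -/

/-- ★★ **`N_S(1)` = CONSTANT BLOCK SUMS**: `toL2S λ ∈ N_S(1) ↔ ∃ C, ∀ y, Σ_{x ∈ B^{K−n}(y)} λ(x) = C`.  (⇐: `λ − (C∕L^{3(K−n)})·𝟙` has zero block sums, hence is residual by
✓`toL2S_mem_NS_one_of_blockSum_eq_zero`, and constants are residual, §1.) [cite: Balaban1985BackgroundPropagators, (3.21) p.394, (3.115) p.418; Balaban1984PropagatorsI, (1.18) p.20] -/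
theorem toL2S_mem_NS_one_iff [Fact (0 < cB)] (lam : Site (F.P K) 0 → Matrix (Fin 2) (Fin 2) ℂ) :
    toL2S F K c₀ lam ∈ NS F n K h c₀ cB (1 : GaugeField (F.P K) 0 (Matrix.specialUnitaryGroup (Fin 2) ℂ)) ↔
      ∃ C : Matrix (Fin 2) (Fin 2) ℂ, ∀ y : Site (F.P K) (K - n), ∑ x ∈ iterBlock (K - n) y, lam x = C := by
  classical
  have hk : K - n ≤ (F.P K).m + (F.P K).K := by have := F.hm; show K - n ≤ F.m + K; omega
  constructor
  · intro hl
    obtain ⟨y₀⟩ : Nonempty (Site (F.P K) (K - n)) := ⟨default⟩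
    exact ⟨∑ x ∈ iterBlock (K - n) y₀, lam x, fun y => blockSum_eq_of_mem_NS_one F n K h c₀ cB lam hl y y₀⟩
  · rintro ⟨C, hC⟩
    -- the block cardinality `N = (L^d)^{K−n}` and the constant `Z := N⁻¹ • C`
    set N : ℕ := ((F.P K).L ^ (F.P K).d) ^ (K - n) with hN
    have hN0 : (N : ℂ) ≠ 0 := by
      rw [hN]; exact_mod_cast pow_ne_zero _ (pow_ne_zero _ (F.P K).L_pos.ne')
    set Z : Matrix (Fin 2) (Fin 2) ℂ := ((N : ℂ)⁻¹) • C with hZ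
    have hsplit : lam = (fun x => lam x - Z) + fun _ => Z := by funext x; simp
    have hzero : ∀ y : Site (F.P K) (K - n), ∑ x ∈ iterBlock (K - n) y, (fun x => lam x - Z) x = 0 := by
      intro y
      rw [Finset.sum_sub_distrib, hC y, Finset.sum_const, card_iterBlock (K - n) hk, ← hN, hZ, ← Nat.cast_smul_eq_nsmul ℂ, smul_smul,
        mul_inv_cancel₀ hN0, one_smul, sub_self]
    rw [hsplit, map_add]
    exact Submodule.add_mem _ (toL2S_mem_NS_one_of_blockSum_eq_zero (h := h) (cB := cB) _ hzero) (toL2S_const_mem_NS_one F n K h c₀ cB Z)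

end Summit.QuantumFields.YangMills.Theorems.Prop7FlatResidualAlgebra

end
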